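import Mathlib
import Summits.MatrixMultiplication.MatrixMultiplication.Theorems.SnSubsetDichotomyHyperoctahedralThresholdSameColourTip

/-!
# Good collisions give clean closed rung walks (extraction with trajectory containment)
(crux `SnSubsetDichotomy.HyperoctahedralThreshold`, stmt-MatrixMultiplication-10883; STUB-PLAN of the open stub
`stub_poorRigidCore` (root-local twin census), target T3 = registered stub `stub_goodCollisionWalk`, the input of the
reduction `stub_rootCensus`)

Vocabulary of the line: `μ 0, μ 1, μ 2` are involutions of `Fin n` (the three perfect matchings); a colour word
`w : List (Fin 3)` acts on the right, `y · w := w.foldl (fun v b => μ b v) y`; REDUCED means `List.IsChain (· ≠ ·) w`,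
CYCLICALLY REDUCED means `List.IsChain (· ≠ ·) (z ++ z)`; the rungs of a word `β` seen from a root rung `(v, x)` are the
pairs `(v · β.take t, x · β.take t)`, `t ≤ |β|` (its two trajectories, read at a common time).

* `GoodCollisionWalk.collision_twin` — two DISTINCT reduced words `t ≠ t'` of EQUAL length acting identically on `p`
  and on `q` yield a non-empty cyclically reduced word `z`, `|z| ≤ |t| + |t'|`, fixing the transported points `p · u`,
  `q · u`, together with TRAJECTORY CONTAINMENT: every point of the `z`-trajectory of `p · u` (resp. `q · u`) is a point
  of the `t`- or of the `t'`-trajectory of `p` (resp. `q`), read in the same word at the same time on both sides.  This is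
  the induction of the tree's `TwinSupply.cyclic_of_collision` (strip equal last letters; strip equal first letters,
  transporting the base points; when both ends differ close up `z := t ++ t'⁻¹`, whose way back is read through
  `SameColourTip.foldl_reverse_take`) re-run CARRYING the containment invariant; equal lengths make the
  fixed-point-freeness used by the tree version unnecessary (no word is ever exhausted).
* `stub_goodCollisionWalk` (the registered stub, verbatim) — hence a colliding pair of distinct reduced words of length
  `a` from a rung `(v, x)`, `v ≠ x`, whose trajectory points avoid `R` and whose rungs are pairwise equal / swapped /
  disjoint (within each word and across the two words), is closed-colour-walk data in the exact format of the conclusion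
  of `stub_poorRigidCore`, with `k + 1 ≤ 2a` rungs: containment transfers both hypotheses to the `z`-walk from
  `(v · u, x · u)` and `SameColourTip.twin_cleanWalk` packages it (`k + 1 = |z| ≤ 2a`).

Pure finite combinatorics; the only hypothesis on the colours is `μ b * μ b = 1`.  No definitions are introduced.
-/

-- the project's summit namespace `Summit.MatrixMultiplication.MatrixMultiplication` repeats a component by design (D-0022)
set_option linter.dupNamespace false

namespace Summit.MatrixMultiplication.MatrixMultiplication.Theorems.HyperoctahedralThreshold

namespace GoodCollisionWalk

variable {n : ℕ}

/-- **Collision ⇒ twin pre-pair, with trajectory containment.**  Two DISTINCT reduced words `t ≠ t'` of equal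
length acting identically on `p` and on `q` yield a word `u` and a non-empty cyclically reduced word `z`,
`|z| ≤ |t| + |t'|`, with `z` fixing `p · u` and `q · u`, such that for every `j ≤ |z|` there are `γ ∈ {t, t'}` and a
time `s ≤ |t|` with `(p · u) · z.take j = p · γ.take s` and `(q · u) · z.take j = q · γ.take s` (same word, same time on
both sides).  Induction on `|t| + |t'|` as in the tree's `TwinSupply.cyclic_of_collision`. [this line] -/
theorem collision_twin (μ : Fin 3 → Equiv.Perm (Fin n)) (hμ : ∀ c, μ c * μ c = 1) :
    ∀ (N : ℕ) (t t' : List (Fin 3)) (p q : Fin n), t.length + t'.length ≤ N → t ≠ t' →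
      t.length = t'.length → List.IsChain (· ≠ ·) t → List.IsChain (· ≠ ·) t' →
      t.foldl (fun v c => μ c v) p = t'.foldl (fun v c => μ c v) p →
      t.foldl (fun v c => μ c v) q = t'.foldl (fun v c => μ c v) q →
      ∃ u z : List (Fin 3), z ≠ [] ∧ List.IsChain (· ≠ ·) (z ++ z) ∧ z.length ≤ t.length + t'.length ∧
        z.foldl (fun v c => μ c v) (u.foldl (fun v c => μ c v) p) = u.foldl (fun v c => μ c v) p ∧
        z.foldl (fun v c => μ c v) (u.foldl (fun v c => μ c v) q) = u.foldl (fun v c => μ c v) q ∧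
        ∀ j ≤ z.length, ∃ γ : List (Fin 3), (γ = t ∨ γ = t') ∧ ∃ s ≤ t.length,
          (z.take j).foldl (fun v c => μ c v) (u.foldl (fun v c => μ c v) p) =
              (γ.take s).foldl (fun v c => μ c v) p ∧
            (z.take j).foldl (fun v c => μ c v) (u.foldl (fun v c => μ c v) q) =
              (γ.take s).foldl (fun v c => μ c v) q := by
  intro N
  induction N with
  | zero =>
    intro t t' p q hN htt
    have h1 : t = [] := List.eq_nil_of_length_eq_zero (by omega)
    have h2 : t' = [] := List.eq_nil_of_length_eq_zero (by omega)
    exact absurd (h1.trans h2.symm) htt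
  | succ N ih =>
    intro t t' p q hN htt hlen hc hc' hp hq
    have ht0 : t ≠ [] := by
      rintro rfl
      exact htt (List.eq_nil_of_length_eq_zero hlen.symm).symm
    have ht0' : t' ≠ [] := by
      rintro rfl
      exact htt (List.eq_nil_of_length_eq_zero hlen)
    -- compare last letters
    obtain ⟨t₂, e, hte⟩ : ∃ t₂ e, t = t₂ ++ [e] := by
      rcases List.eq_nil_or_concat t with h | ⟨t₂, e, h⟩
      · exact absurd h ht0
      · exact ⟨t₂, e, by rw [h, List.concat_eq_append]⟩
    obtain ⟨t₂', e', hte'⟩ : ∃ t₂' e', t' = t₂' ++ [e'] := by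
      rcases List.eq_nil_or_concat t' with h | ⟨t₂', e', h⟩
      · exact absurd h ht0'
      · exact ⟨t₂', e', by rw [h, List.concat_eq_append]⟩
    by_cases hee : e = e'
    · -- equal last letters: strip them (letters act injectively); prefixes of `t₂` are prefixes of `t`
      subst hee hte hte'
      have strip : ∀ r : Fin n, (t₂ ++ [e]).foldl (fun v c => μ c v) r = (t₂' ++ [e]).foldl (fun v c => μ c v) r →
          t₂.foldl (fun v c => μ c v) r = t₂'.foldl (fun v c => μ c v) r := by
        intro r hr
        rw [List.foldl_concat, List.foldl_concat] at hr
        exact (μ e).injective hr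
      have hne : t₂ ≠ t₂' := fun h => htt (by rw [h])
      have hN' : t₂.length + t₂'.length ≤ N := by
        simp only [List.length_append, List.length_singleton] at hN; omega
      have hlen' : t₂.length = t₂'.length := by
        simp only [List.length_append, List.length_singleton] at hlen; omega
      obtain ⟨u, z, h1, h2, h3, h4, h5, h6⟩ := ih t₂ t₂' p q hN' hne hlen' hc.left_of_append
        hc'.left_of_append (strip p hp) (strip q hq)
      refine ⟨u, z, h1, h2, by simp only [List.length_append, List.length_singleton]; omega, h4, h5, ?_⟩
      intro j hj
      obtain ⟨γ, hγ, s, hs, e1, e2⟩ := h6 j hj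
      have hsγ : s ≤ γ.length := by rcases hγ with rfl | rfl <;> omega
      refine ⟨γ ++ [e], by rcases hγ with rfl | rfl <;> simp, s,
        by simp only [List.length_append, List.length_singleton]; omega, ?_, ?_⟩
      · rw [List.take_append_of_le_length hsγ]; exact e1
      · rw [List.take_append_of_le_length hsγ]; exact e2
    -- last letters differ: compare first letters
    obtain ⟨d, t₁, htd⟩ := List.exists_cons_of_ne_nil ht0
    obtain ⟨d', t₁', htd'⟩ := List.exists_cons_of_ne_nil ht0'
    by_cases hdd : d = d'
    · -- equal first letters: strip them, transporting the base points along `d`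
      subst hdd htd htd'
      rw [List.foldl_cons, List.foldl_cons] at hp hq
      have hne : t₁ ≠ t₁' := fun h => htt (by rw [h])
      have hN' : t₁.length + t₁'.length ≤ N := by
        simp only [List.length_cons] at hN; omega
      have hlen' : t₁.length = t₁'.length := by simpa using hlen
      obtain ⟨u, z, h1, h2, h3, h4, h5, h6⟩ := ih t₁ t₁' (μ d p) (μ d q) hN' hne hlen'
        (List.isChain_cons.1 hc).2 (List.isChain_cons.1 hc').2 hp hq
      refine ⟨d :: u, z, h1, h2, by simp only [List.length_cons]; omega,
        by simpa only [List.foldl_cons] using h4, by simpa only [List.foldl_cons] using h5, ?_⟩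
      intro j hj
      obtain ⟨γ, hγ, s, hs, e1, e2⟩ := h6 j hj
      refine ⟨d :: γ, by rcases hγ with rfl | rfl <;> simp, s + 1, by simp only [List.length_cons]; omega, ?_, ?_⟩
      · rw [List.foldl_cons, List.take_succ_cons, List.foldl_cons]; exact e1
      · rw [List.foldl_cons, List.take_succ_cons, List.foldl_cons]; exact e2
    -- both ends differ: close up `z := t ++ t'.reverse` (`u := []`)
    have hrev : ∀ r : Fin n, t.foldl (fun v c => μ c v) r = t'.foldl (fun v c => μ c v) r →
        (t ++ t'.reverse).foldl (fun v c => μ c v) r = r := by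
      intro r hr
      rw [List.foldl_append, hr]
      exact SameColourTip.foldl_act_reverse μ hμ t' r
    have hcr : List.IsChain (· ≠ ·) t'.reverse :=
      List.isChain_reverse.2 (hc'.imp fun a b h => fun h' => h h'.symm)
    have hz : List.IsChain (· ≠ ·) (t ++ t'.reverse) := by
      refine List.isChain_append.2 ⟨hc, hcr, ?_⟩
      intro x hx y hy
      rw [hte, List.getLast?_concat] at hx
      rw [List.head?_reverse, hte', List.getLast?_concat] at hy
      simp only [Option.mem_def, Option.some.injEq] at hx hy
      subst hx; subst hy
      exact hee
    have hzz : List.IsChain (· ≠ ·) ((t ++ t'.reverse) ++ (t ++ t'.reverse)) := by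
      refine List.isChain_append.2 ⟨hz, hz, ?_⟩
      intro x hx y hy
      have ht'r : t'.reverse ≠ [] := by simpa using ht0'
      rw [List.getLast?_append_of_ne_nil _ ht'r, List.getLast?_reverse, htd', List.head?_cons] at hx
      rw [List.head?_append, htd, List.head?_cons, Option.some_or] at hy
      simp only [Option.mem_def, Option.some.injEq] at hx hy
      subst hx; subst hy
      exact fun h => hdd h.symm
    refine ⟨[], t ++ t'.reverse, by simp [ht0], hzz, by simp, by simpa using hrev p hp,
      by simpa using hrev q hq, ?_⟩
    intro j hj
    rw [List.foldl_nil, List.foldl_nil]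
    by_cases hjt : j ≤ t.length
    · -- on the way out along `t`
      refine ⟨t, Or.inl rfl, j, hjt, ?_, ?_⟩
      · rw [List.take_append_of_le_length hjt]
      · rw [List.take_append_of_le_length hjt]
    · -- on the way back along `t'⁻¹`: `i` steps back from `p · t = p · t'` is `p · t'.take (|t'| - i)`
      obtain ⟨i, rfl⟩ : ∃ i, j = t.length + i := ⟨j - t.length, by omega⟩
      have hi : i ≤ t'.length := by
        simp only [List.length_append, List.length_reverse] at hj; omega
      rw [List.take_length_add_append, List.foldl_append, List.foldl_append, hp, hq]
      exact ⟨t', Or.inr rfl, t'.length - i, by omega, SameColourTip.foldl_reverse_take μ hμ t' i p,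
        SameColourTip.foldl_reverse_take μ hμ t' i q⟩

end GoodCollisionWalk

open GoodCollisionWalk in
/-- **Registered stub `stub_goodCollisionWalk`** (STUB-PLAN target T3 for the line `stub_poorRigidCore`, verbatim):
a colliding pair of distinct reduced words `β ≠ β'` of length `a` from the rung `(v, x)` (`v · β = v · β'`,
`x · β = x · β'`), all of whose trajectory points avoid `R` and all of whose rungs (within each word and across) are
pairwise equal, swapped or disjoint, yields closed-colour-walk data in the format of the conclusion of
`stub_poorRigidCore` with `k + 1 ≤ 2a` rungs.  Proof: `collision_twin` (containment transfers the two hypotheses to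
the closed `z`-walk) and `SameColourTip.twin_cleanWalk`. [this line] -/
theorem stub_goodCollisionWalk : ∀ (n a : ℕ) (μ : Fin 3 → Equiv.Perm (Fin n)) (R : Finset (Fin n)) (v x : Fin n) (β β' : List (Fin 3)), (∀ b, μ b * μ b = 1) → v ≠ x → β.length = a → β'.length = a → β ≠ β' → List.IsChain (· ≠ ·) β → List.IsChain (· ≠ ·) β' → β.foldl (fun v b => μ b v) v = β'.foldl (fun v b => μ b v) v → β.foldl (fun v b => μ b v) x = β'.foldl (fun v b => μ b v) x → (∀ t ≤ a, (β.take t).foldl (fun v b => μ b v) v ∉ R ∧ (β.take t).foldl (fun v b => μ b v) x ∉ R ∧ (β'.take t).foldl (fun v b => μ b v) v ∉ R ∧ (β'.take t).foldl (fun v b => μ b v) x ∉ R) → (∀ γ γ' : List (Fin 3), (γ = β ∨ γ = β') → (γ' = β ∨ γ' = β') → ∀ s ≤ a, ∀ t ≤ a, ((γ.take s).foldl (fun v b => μ b v) v = (γ'.take t).foldl (fun v b => μ b v) v ∧ (γ.take s).foldl (fun v b => μ b v) x = (γ'.take t).foldl (fun v b => μ b v) x) ∨ ((γ.take s).foldl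 (fun v b => μ b v) v = (γ'.take t).foldl (fun v b => μ b v) x ∧ (γ.take s).foldl (fun v b => μ b v) x = (γ'.take t).foldl (fun v b => μ b v) v) ∨ ((γ.take s).foldl (fun v b => μ b v) v ≠ (γ'.take t).foldl (fun v b => μ b v) v ∧ (γ.take s).foldl (fun v b => μ b v) v ≠ (γ'.take t).foldl (fun v b => μ b v) x ∧ (γ.take s).foldl (fun v b => μ b v) x ≠ (γ'.take t).foldl (fun v b => μ b v) v ∧ (γ.take s).foldl (fun v b => μ b v) x ≠ (γ'.take t).foldl (fun v b => μ b v) x)) → ∃ (k : ℕ) (p q : Fin (k + 1) → Fin n) (col : Fin (k + 1) → Fin 3), (∀ i, p i ≠ q i) ∧ (∀ i, (μ (col i) (p i) = p (i + 1) ∧ μ (col i) (q i) = q (i + 1)) ∨ (μ (col i) (p i) = q (i + 1) ∧ μ (col i) (q i) = p (i + 1))) ∧ (∀ i, col i ≠ col (i + 1)) ∧ (∀ i j, (p i = p j ∧ q i = q j) ∨ (p i = q j ∧ q i = p j) ∨ (p i ≠ p j ∧ p i ≠ q j ∧ q i ≠ p j ∧ q i ≠ q j)) ∧ (∀ i, p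 i ∉ R ∧ q i ∉ R) ∧ k + 1 ≤ 2 * a := by
  intro n a μ R v x β β' hμ hvx hβ hβ' hne hc hc' hcv hcx hR heod
  obtain ⟨u, z, hz1, hzc, hzl, hfv, hfx, hcont⟩ :=
    collision_twin μ hμ (β.length + β'.length) β β' v x le_rfl hne (hβ.trans hβ'.symm) hc hc' hcv hcx
  obtain ⟨k, p, q, col, h1, h2, h3, h4, h5, hk⟩ := SameColourTip.twin_cleanWalk μ R z hz1 hzc
    (u.foldl (fun v c => μ c v) v) (u.foldl (fun v c => μ c v) x)
    (fun h => hvx (GoodTwin.foldl_injective μ u h)) hfv hfx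
    (by
      -- equal-or-disjointness of the rungs of the `z`-walk: they are rungs of `β` or of `β'`
      intro s t hs ht
      obtain ⟨γ₁, hγ₁, s₁, hs₁, e1, e2⟩ := hcont s hs.le
      obtain ⟨γ₂, hγ₂, s₂, hs₂, e3, e4⟩ := hcont t ht.le
      rw [e1, e2, e3, e4]
      exact heod γ₁ γ₂ hγ₁ hγ₂ s₁ (by omega) s₂ (by omega))
    (by
      -- `R`-avoidance of the `z`-walk
      intro t ht
      obtain ⟨γ, hγ, s, hs, e1, e2⟩ := hcont t ht.le
      rw [e1, e2]
      rcases hγ with rfl | rfl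
      · exact ⟨(hR s (by omega)).1, (hR s (by omega)).2.1⟩
      · exact ⟨(hR s (by omega)).2.2.1, (hR s (by omega)).2.2.2⟩)
  exact ⟨k, p, q, col, h1, h2, h3, h4, h5, by omega⟩

end Summit.MatrixMultiplication.MatrixMultiplication.Theorems.HyperoctahedralThreshold
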